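import Mathlib.Analysis.Calculus.Deriv.Mul
import Mathlib.Analysis.Calculus.Deriv.Add
import Literature.Analysis.ODE.OneSidedComparison
import HarnessLib

/-!
# Adjoint-certificate read-out inequality (layer R of the ramp enclosure;
# `pub-fluidc-bp3/R1-DESIGN.md` §6 G2/G5 (K5), G10)

HONEST FRAMING (cell `pub-fluidc`, blueprint seat bp3, gen 17): low prior, high value-of-information
experiment on Tao's machine paradigm; NOT a claim that NS blows up. Pure real analysis.

LAYER R of the two-layer ramp enclosure reads a linear functional `λ · z(t*)` of the deviation out of
the tube of layer T not by the crude `Σ |λᵢ| Wᵢ(t*)` but through an ADJOINT CERTIFICATE: any `C¹`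
(here: right-differentiable, tabulated piecewise-polynomial) covector field `λ̂(s)` with tabulated
derivative `μ = λ̂'`, for which the kernel certifies on each piece an entrywise RESIDUAL bound
`|μⱼ + Σᵢ λ̂ᵢ Kᵢⱼ| ≤ ρⱼ` (how far `λ̂` is from solving the adjoint equation `λ̂' = −Kᵀλ̂`) and a size
bound `|λ̂ᵢ| ≤ Λᵢ`. Then along any solution of `zᵢ' = Σⱼ Kᵢⱼ zⱼ + fᵢ` staying in the tube
`|zⱼ| ≤ Wⱼ` with forcing `|fᵢ| ≤ φᵢ`, the pairing `g(s) = Σᵢ λ̂ᵢ(s) zᵢ(s)` moves by at most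
`h (Σⱼ ρⱼ Wⱼ + Σᵢ Λᵢ φᵢ)` over the piece (`pairing_step`), and such piece bounds add up along the
window (`pairing_chain`). With an exact adjoint solution the `ρ`-term vanishes and only the forcing is
paid — this is what brings the read-out from the tube's own `0.75 L` to `0.58 L` in the probe
(R1-DESIGN §6 G3). The proof is the mean-value inequality for `g` (right derivatives).

CONTENTS (sorry-free): `pairing_hasDerivWithinAt` (product/sum rule for the pairing),
`pairing_deriv_bound` (the rearrangement `g' = Σⱼ (μⱼ + Σᵢ λ̂ᵢKᵢⱼ) zⱼ + Σᵢ λ̂ᵢ fᵢ` and its bound),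
**`pairing_step`**, **`pairing_chain`** (telescoping over consecutive pieces with tabulated per-piece
bounds).

References: folklore (adjoint / duality error representation for linear ODEs), cf. T. Tao,
*Nonlinear dispersive equations*, CBMS 106 (2006), §1.3 (Duhamel and energy methods).

[cite: Tao2016AveragedNS, §5.5 Thm 5.3 (5.5)]
-/

noncomputable section

open Set Real Filter Topology

namespace Summit.NavierStokesRegularity.FluidComputer

namespace AdjointReadout

open Literature.Analysis.ODE

variable {ι : Type*} [Fintype ι]

/-- Product/sum rule: the pairing `s ↦ Σᵢ λ̂ᵢ(s) zᵢ(s)` has right derivative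
`Σᵢ (μᵢ zᵢ + λ̂ᵢ (Σⱼ Kᵢⱼ zⱼ + fᵢ))`. [folklore] -/
theorem pairing_hasDerivWithinAt {z lam mu : ℝ → ι → ℝ} {K : ℝ → ι → ι → ℝ} {f : ℝ → ι → ℝ}
    {s : ℝ}
    (hz : ∀ i, HasDerivWithinAt (fun r => z r i) (∑ j, K s i j * z s j + f s i) (Ici s) s)
    (hl : ∀ i, HasDerivWithinAt (fun r => lam r i) (mu s i) (Ici s) s) :
    HasDerivWithinAt (fun r => ∑ i, lam r i * z r i)
      (∑ i, (mu s i * z s i + lam s i * (∑ j, K s i j * z s j + f s i))) (Ici s) s := by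
  have : ∀ i ∈ (Finset.univ : Finset ι), HasDerivWithinAt (fun r => lam r i * z r i)
      (mu s i * z s i + lam s i * (∑ j, K s i j * z s j + f s i)) (Ici s) s :=
    fun i _ => (hl i).mul (hz i)
  exact HasDerivWithinAt.fun_sum this

/-- The rearrangement of the pairing's derivative and its bound from the residual, size, tube and
forcing tables: `|Σᵢ (μᵢ zᵢ + λ̂ᵢ (Σⱼ Kᵢⱼ zⱼ + fᵢ))| ≤ Σⱼ ρⱼ Wⱼ + Σᵢ Λᵢ φᵢ`. [folklore] -/
theorem pairing_deriv_bound {zs ls ms fs : ι → ℝ} {Ks : ι → ι → ℝ} {W φ ρ Λ : ι → ℝ}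
    (hW : ∀ j, |zs j| ≤ W j) (hf : ∀ i, |fs i| ≤ φ i)
    (hρ : ∀ j, |ms j + ∑ i, ls i * Ks i j| ≤ ρ j) (hΛ : ∀ i, |ls i| ≤ Λ i) :
    |∑ i, (ms i * zs i + ls i * (∑ j, Ks i j * zs j + fs i))| ≤ ∑ j, ρ j * W j + ∑ i, Λ i * φ i := by
  classical
  have hre : ∑ i, (ms i * zs i + ls i * (∑ j, Ks i j * zs j + fs i))
      = ∑ j, (ms j + ∑ i, ls i * Ks i j) * zs j + ∑ i, ls i * fs i := by
    have h1 : ∑ i, (ms i * zs i + ls i * (∑ j, Ks i j * zs j + fs i))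
        = ∑ i, ms i * zs i + ∑ i, ls i * (∑ j, Ks i j * zs j) + ∑ i, ls i * fs i := by
      simp only [mul_add, Finset.sum_add_distrib]
      ring
    have h2 : ∑ i, ls i * (∑ j, Ks i j * zs j) = ∑ j, (∑ i, ls i * Ks i j) * zs j := by
      simp only [Finset.mul_sum, Finset.sum_mul]
      rw [Finset.sum_comm]
      exact Finset.sum_congr rfl fun j _ => Finset.sum_congr rfl fun i _ => by ring
    have h3 : ∑ j, (ms j + ∑ i, ls i * Ks i j) * zs j
        = ∑ j, ms j * zs j + ∑ j, (∑ i, ls i * Ks i j) * zs j := by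
      simp only [add_mul, Finset.sum_add_distrib]
    rw [h1, h2, h3]
  rw [hre]
  refine (abs_add_le _ _).trans (add_le_add ?_ ?_)
  · refine (Finset.abs_sum_le_sum_abs _ _).trans (Finset.sum_le_sum fun j _ => ?_)
    rw [abs_mul]
    exact mul_le_mul (hρ j) (hW j) (abs_nonneg _) ((abs_nonneg _).trans (hρ j))
  · refine (Finset.abs_sum_le_sum_abs _ _).trans (Finset.sum_le_sum fun i _ => ?_)
    rw [abs_mul]
    exact mul_le_mul (hΛ i) (hf i) (abs_nonneg _) ((abs_nonneg _).trans (hΛ i))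

/-- **Adjoint-certificate read-out over one piece.** `z` solves `zᵢ' = Σⱼ Kᵢⱼ zⱼ + fᵢ` on
`[t₀, t₀+h)` (right derivatives; `z`, `λ̂` continuous on `[t₀, t₀+h]`), `λ̂` has right derivative
`μ`, and on the piece `|zⱼ| ≤ Wⱼ`, `|fᵢ| ≤ φᵢ`, `|μⱼ + Σᵢ λ̂ᵢKᵢⱼ| ≤ ρⱼ`, `|λ̂ᵢ| ≤ Λᵢ`. Then
`|Σᵢ λ̂ᵢ(t₀+h) zᵢ(t₀+h) − Σᵢ λ̂ᵢ(t₀) zᵢ(t₀)| ≤ h (Σⱼ ρⱼ Wⱼ + Σᵢ Λᵢ φᵢ)`. [folklore] -/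
theorem pairing_step {z lam mu : ℝ → ι → ℝ} {K : ℝ → ι → ι → ℝ} {f : ℝ → ι → ℝ}
    {W φ ρ Λ : ι → ℝ} {t₀ h : ℝ} (hh : 0 ≤ h)
    (hzc : ∀ i, ContinuousOn (fun s => z s i) (Icc t₀ (t₀ + h)))
    (hz : ∀ s ∈ Ico t₀ (t₀ + h), ∀ i,
      HasDerivWithinAt (fun r => z r i) (∑ j, K s i j * z s j + f s i) (Ici s) s)
    (hlc : ∀ i, ContinuousOn (fun s => lam s i) (Icc t₀ (t₀ + h)))
    (hl : ∀ s ∈ Ico t₀ (t₀ + h), ∀ i, HasDerivWithinAt (fun r => lam r i) (mu s i) (Ici s) s)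
    (hW : ∀ s ∈ Ico t₀ (t₀ + h), ∀ j, |z s j| ≤ W j)
    (hf : ∀ s ∈ Ico t₀ (t₀ + h), ∀ i, |f s i| ≤ φ i)
    (hρ : ∀ s ∈ Ico t₀ (t₀ + h), ∀ j, |mu s j + ∑ i, lam s i * K s i j| ≤ ρ j)
    (hΛ : ∀ s ∈ Ico t₀ (t₀ + h), ∀ i, |lam s i| ≤ Λ i) :
    |∑ i, lam (t₀ + h) i * z (t₀ + h) i - ∑ i, lam t₀ i * z t₀ i|
      ≤ h * (∑ j, ρ j * W j + ∑ i, Λ i * φ i) := by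
  have hgc : ContinuousOn (fun s => ∑ i, lam s i * z s i) (Icc t₀ (t₀ + h)) :=
    continuousOn_finsetSum _ fun i _ => (hlc i).mul (hzc i)
  have hgd : ∀ s ∈ Ico t₀ (t₀ + h), HasDerivWithinAt (fun r => ∑ i, lam r i * z r i)
      (∑ i, (mu s i * z s i + lam s i * (∑ j, K s i j * z s j + f s i))) (Ici s) s :=
    fun s hs => pairing_hasDerivWithinAt (hz s hs) (hl s hs)
  have hbd : ∀ s ∈ Ico t₀ (t₀ + h),
      |∑ i, (mu s i * z s i + lam s i * (∑ j, K s i j * z s j + f s i))|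
        ≤ ∑ j, ρ j * W j + ∑ i, Λ i * φ i :=
    fun s hs => pairing_deriv_bound (hW s hs) (hf s hs) (hρ s hs) (hΛ s hs)
  have hmv := abs_sub_le_mul_of_abs_deriv_right_le hgc hgd hbd (t₀ + h) ⟨by linarith, le_rfl⟩
  have harith : (∑ j, ρ j * W j + ∑ i, Λ i * φ i) * (t₀ + h - t₀)
      = h * (∑ j, ρ j * W j + ∑ i, Λ i * φ i) := by ring
  rw [harith] at hmv
  exact hmv

/-- **Telescoping along the window.** If consecutive pieces `[τ k, τ (k+1)]` carry pairing bounds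
`|g(τ (k+1)) − g(τ k)| ≤ d k` (each an instance of `pairing_step` with its own tables), then
`|g(τ n) − g(τ 0)| ≤ Σ_{k<n} d k`. [folklore] -/
theorem pairing_chain {g : ℝ → ℝ} {τ : ℕ → ℝ} {d : ℕ → ℝ}
    (hstep : ∀ k, |g (τ (k + 1)) - g (τ k)| ≤ d k) (n : ℕ) :
    |g (τ n) - g (τ 0)| ≤ ∑ k ∈ Finset.range n, d k := by
  induction n with
  | zero => simp
  | succ n ih =>
    rw [Finset.sum_range_succ]
    have : g (τ (n + 1)) - g (τ 0) = (g (τ (n + 1)) - g (τ n)) + (g (τ n) - g (τ 0)) := by ring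
    rw [this]
    exact (abs_add_le _ _).trans (by linarith [hstep n])

end AdjointReadout

end Summit.NavierStokesRegularity.FluidComputer
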